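import Summits.BirchSwinnertonDyer.BirchSwinnertonDyer.Theorems.ClassRecordThreeEulerHalvesAtThreeCartanCoverInertHecke
import Summits.BirchSwinnertonDyer.BirchSwinnertonDyer.Theorems.ClassRecordThreeEulerHalvesAtThreeCartanCoverHeckePeriods
import HarnessLib

/-!
# Hecke operators on additive cochains (part A: the generic `HeckeDatum` layer T1–T6, T8, T9) — the inert-Hecke certificate for (OBS) `CartanCover.Charext.NoModThreePeriodCharacterExtension`

Support file for crux `CartanOnePlaceDegreeLawAtThree` (item stmt-BirchSwinnertonDyer-24801; lines `Lines/lattice` v6 ∕ `Lines/charext` v10, shared Galois leaf (OBS)).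
Source: `Cruxes/CartanOnePlaceDegreeLawAtThree/Lines/charext.lean` v10 §InertHecke (TYPED AND PROVED by the crux ideator cruxidea-24801-1 g0, 2026-08-29, SORRY-FREE; mirror
`HOME/cruxidea-24801-1/g0/…CartanCoverHeckeDatum.lean` 7c65ea06bbc225cb); LANDED in two parts (≤ 400 lines each; statements byte-identical) by the crux LEAD tam3-p1 g27. Contents:
`HeckeDatum Γ ι` (representatives `α`, coset permutations `σ`, `mem`, `disj`; `σ_unique ∕ σ_mul ∕ σ_one ∕ σ_eq_self_of_comm`; `ofStable`; `op χ γ = Σ_i χ(α i γ α(σ γ i)⁻¹)`) with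
(T1) `op_mul`, (T2) `op_apply_of_normalised`, (T2′) `restrict ∕ op_restrict ∕ memN_of_reduction`, (T8) `changeReps ∕ op_changeReps`, (T9) `exists_changeReps_commonReduction`,
(T3) `op_apply_eq_zero_of_cube_central`, (T4) `apply_eq_zero_of_eigen`, (T5) `eigen_of_eigen_on`; (T6) `fixedPointFree_of_projective_equivariance` (+ `ne_one_of_sq_add_self_add_one_eq_zero`,
`cube_eq_one_of_sq_add_self_add_one_eq_zero`); (T7) `gammaHeckeDatum X n` + `period_op_eq_smul` (the Hecke–period identity `period_smul_eq_sum` through `op`); (T10) `unitsHeckeSet ∕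
unitsHeckeSetoid ∕ units_exists_perm_mul ∕ unitsHeckeDatum` for the norm-one group of any order and `coverHeckeDatum X q n : HeckeDatum (coverUnits X q) _`.
Uses the landed bricks `sum_eq_zero_of_three_cycles`, `no_eigenvector_of_cube_eq_one` (p737917) by name. Nothing here is specific to a curve; BSD is proved for no curve.
-/

set_option linter.dupNamespace false
set_option autoImplicit false

noncomputable section

open scoped Classical Pointwise MatrixGroups UpperHalfPlane

namespace Summit.BirchSwinnertonDyer.BirchSwinnertonDyer.Theorems.CartanCover.Charext

open Literature.NumberTheory.Automorphic

namespace InertHecke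

/-! (v10) the v8.1 bricks β₁ `no_eigenvector_of_cube_eq_one`, β₂ `sum_eq_zero_of_three_cycles` ∕ `hecke_sum_eq_zero_of_three_cycles[_central]`, CHEB `exists_det_neg_one_trace_ne_zero`,
the unipotent factorisation `exists_unip_factorization`, `additive_trivial_of_trivial_on_ker` and (RES-INJ) `modThree_trivial_of_trivial_on_principalLevel` are TREE THEOREMS now
(LEAD tam3-p1 g27, p737917 `…CartanCoverInertHecke`, namespace `CartanCover.Charext.InertHecke`) and are used BY NAME below. What this section adds (v9.1–v9.5, not yet in Theorems):
`HeckeDatum` with (T1) `op_mul`, (T2) `op_apply_of_normalised`, (T2′) `restrict` ∕ `op_restrict` ∕ `memN_of_reduction`, (T3) `op_apply_eq_zero_of_cube_central`, (T4) `apply_eq_zero_of_eigen`,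
`ofStable`, (T5) `eigen_of_eigen_on`, (T6) `fixedPointFree_of_projective_equivariance` (+ `ne_one_…`, `cube_eq_one_…`), (T7) `gammaHeckeDatum` ∕ `period_op_eq_smul`. -/


/-! #### (T6) fixed-point-freeness of elliptic order-3 elements on `ℙ¹(𝔽_ℓ)`-indexed cosets — PROVED (v9.3) -/

/-- **(T6) fixed-point-freeness from projective equivariance**: if the coset permutation `τ` of `x` is intertwined, up to non-zero scalars, with the action of a matrix
`x̄ ∈ M₂(𝔽_ℓ)` (`x̄³ = 1`, `x̄ ≠ 1`, `ℓ ≡ 2 (mod 3)`) on non-zero vectors — `x̄ · e i = c_i · e (τ i)` — then `τ` has no fixed point: a fixed coset would be an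
`x̄`-stable line, i.e. an eigenvector, excluded by `no_eigenvector_of_cube_eq_one`. (The intertwining map `e : ι → 𝔽_ℓ² ∖ 0` is the identification of the `ℓ + 1` cosets of
`T_ℓ` with `ℙ¹(𝔽_ℓ)`.) [folklore] -/
theorem fixedPointFree_of_projective_equivariance {ℓ : ℕ} [Fact ℓ.Prime] (hℓ : ℓ % 3 = 2)
    (xbar : Matrix (Fin 2) (Fin 2) (ZMod ℓ)) (hx3 : xbar ^ 3 = 1) (hx1 : xbar ≠ 1)
    {ι : Type*} (τ : ι → ι) (e : ι → (Fin 2 → ZMod ℓ)) (he : ∀ i, e i ≠ 0)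
    (hequi : ∀ i, ∃ c : ZMod ℓ, xbar.mulVec (e i) = c • e (τ i)) :
    ∀ i, τ i ≠ i := by
  intro i hi
  obtain ⟨c, hc⟩ := hequi i
  rw [hi] at hc
  exact no_eigenvector_of_cube_eq_one hℓ xbar hx3 hx1 ⟨c, e i, he i, hc⟩

/-- the reduction of an elliptic element of order `3` is never `1 (mod ℓ)` for `ℓ ≠ 3`… in the abstract form the certificate uses: if `x̄ = 1` then `x̄² + x̄ + 1 = 3 = 0`
in `M₂(𝔽_ℓ)`, forcing `ℓ ∣ 3`. -/
theorem ne_one_of_sq_add_self_add_one_eq_zero {ℓ : ℕ} [Fact ℓ.Prime] (hℓ3 : ℓ ≠ 3)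
    (xbar : Matrix (Fin 2) (Fin 2) (ZMod ℓ)) (hmin : xbar ^ 2 + xbar + 1 = 0) : xbar ≠ 1 := by
  intro h
  rw [h, one_pow] at hmin
  have e := congrArg (fun m : Matrix (Fin 2) (Fin 2) (ZMod ℓ) => m 0 0) hmin
  simp only [Matrix.add_apply, Matrix.one_apply_eq, Matrix.zero_apply] at e
  have h3' : ((3 : ℕ) : ZMod ℓ) = 0 := by
    rw [← e]; norm_num
  rw [ZMod.natCast_eq_zero_iff] at h3'
  have hp : ℓ.Prime := Fact.out
  have := (Nat.prime_dvd_prime_iff_eq hp Nat.prime_three).mp h3'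
  exact hℓ3 this

/-- … and `x̄² + x̄ + 1 = 0` gives `x̄³ = 1`. -/
theorem cube_eq_one_of_sq_add_self_add_one_eq_zero {R : Type*} [Ring R] (x : R) (hmin : x ^ 2 + x + 1 = 0) : x ^ 3 = 1 := by
  have : x ^ 3 - 1 = (x - 1) * (x ^ 2 + x + 1) := by noncomm_ring
  rw [hmin, mul_zero, sub_eq_zero] at this
  exact this


/-! #### (HECKE-ABS) Hecke operators on additive cochains — additivity, restriction, vanishing at elliptic 3-cycle elements, eigen ⇒ vanishing — PROVED (v9.1) -/

/-- **Hecke datum** on a subgroup `Γ ≤ 𝔾`: finitely many representatives `α i` of the right cosets `Γ α i` of a `Γ`-stable finite union `⋃ Γ α i` (a double coset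
`Γ α Γ`), pairwise `Γ`-inequivalent (`disj`), with the coset permutation `σ γ` of each `γ ∈ Γ` (`mem`: `α i · γ ∈ Γ · α (σ γ i)`). [folklore] -/
structure HeckeDatum {𝔾 : Type*} [Group 𝔾] (Γ : Subgroup 𝔾) (ι : Type*) where
  α : ι → 𝔾
  σ : Γ → Equiv.Perm ι
  mem : ∀ (γ : Γ) (i : ι), α i * γ * (α (σ γ i))⁻¹ ∈ Γ
  disj : ∀ (i j : ι) (g : 𝔾), g ∈ Γ → α i = g * α j → i = j

namespace HeckeDatum

variable {𝔾 : Type*} [Group 𝔾] {Γ : Subgroup 𝔾} {ι : Type*} (H : HeckeDatum Γ ι)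

/-- uniqueness of the coset permutation. -/
theorem σ_unique (γ : Γ) (i j : ι) (h : H.α i * γ * (H.α j)⁻¹ ∈ Γ) : j = H.σ γ i := by
  have h' := H.mem γ i
  -- (α i γ α j⁻¹)⁻¹ * (α i γ α (σ γ i)⁻¹) = α j * α (σ γ i)⁻¹ ∈ Γ
  have hq : H.α j * (H.α (H.σ γ i))⁻¹ ∈ Γ := by
    have := Γ.mul_mem (Γ.inv_mem h) h'
    have e : (H.α i * γ * (H.α j)⁻¹)⁻¹ * (H.α i * γ * (H.α (H.σ γ i))⁻¹) = H.α j * (H.α (H.σ γ i))⁻¹ := by group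
    rwa [e] at this
  exact H.disj j (H.σ γ i) _ hq (by group)

/-- the coset permutation is an anti-action: `σ (γ δ) = σ δ ∘ σ γ`. [folklore] -/
theorem σ_mul (γ δ : Γ) (i : ι) : H.σ (γ * δ) i = H.σ δ (H.σ γ i) := by
  symm
  apply H.σ_unique (γ * δ) i
  have e : H.α i * ((γ * δ : Γ) : 𝔾) * (H.α (H.σ δ (H.σ γ i)))⁻¹
      = (H.α i * γ * (H.α (H.σ γ i))⁻¹) * (H.α (H.σ γ i) * δ * (H.α (H.σ δ (H.σ γ i)))⁻¹) := by
    rw [Subgroup.coe_mul]; group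
  rw [e]; exact Γ.mul_mem (H.mem γ i) (H.mem δ (H.σ γ i))

/-- `σ 1 = id`. [folklore] -/
theorem σ_one (i : ι) : H.σ 1 i = i := by
  symm; apply H.σ_unique 1 i i
  rw [Subgroup.coe_one, mul_one, mul_inv_cancel]; exact Γ.one_mem

/-- an element `c ∈ Γ` commuting with every representative has trivial coset permutation. -/
theorem σ_eq_self_of_comm (c : Γ) (hc : ∀ i, H.α i * c = c * H.α i) (i : ι) : H.σ c i = i := by
  symm; apply H.σ_unique c i i
  rw [hc, mul_assoc, mul_inv_cancel, mul_one]; exact c.2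

/-- **constructor from stability**: pairwise `Γ`-inequivalent representatives `α : ι → 𝔾` (finite `ι`) of a right-`Γ`-stable union of cosets (`stab`: every `α i · γ` lies in
some `Γ · α j`) carry a (unique) Hecke datum — the coset map is injective by `disj`, hence a permutation of the finite `ι`. [folklore] -/
noncomputable def ofStable [Finite ι] (α : ι → 𝔾) (disj : ∀ (i j : ι) (g : 𝔾), g ∈ Γ → α i = g * α j → i = j)
    (stab : ∀ (γ : Γ) (i : ι), ∃ j, α i * γ * (α j)⁻¹ ∈ Γ) : HeckeDatum Γ ι := by
  classical
  let f : Γ → ι → ι := fun γ i => (stab γ i).choose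
  have hf : ∀ γ i, α i * γ * (α (f γ i))⁻¹ ∈ Γ := fun γ i => (stab γ i).choose_spec
  have hinj : ∀ γ, Function.Injective (f γ) := by
    intro γ i i' h
    -- α i γ α j⁻¹ ∈ Γ and α i' γ α j⁻¹ ∈ Γ with j = f γ i = f γ i' ⇒ α i α i'⁻¹ ∈ Γ
    have h1 := hf γ i; have h2 := hf γ i'
    rw [h] at h1
    have h3 : α i * (α i')⁻¹ ∈ Γ := by
      have := Γ.mul_mem h1 (Γ.inv_mem h2)
      have e : α i * γ * (α (f γ i'))⁻¹ * (α i' * γ * (α (f γ i'))⁻¹)⁻¹ = α i * (α i')⁻¹ := by group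
      rwa [e] at this
    exact disj i i' _ h3 (by group)
  exact
    { α := α
      σ := fun γ => Equiv.ofBijective (f γ) (Finite.injective_iff_bijective.mp (hinj γ))
      mem := fun γ i => hf γ i
      disj := disj }

/-- the representatives of `ofStable` are the given ones. [folklore] -/
@[simp] theorem ofStable_α [Finite ι] (α : ι → 𝔾) (disj) (stab : ∀ (γ : Γ) (i : ι), ∃ j, α i * γ * (α j)⁻¹ ∈ Γ) :
    (ofStable α disj stab).α = α := by
  classical
  unfold ofStable; rfl

variable {A : Type*} [AddCommGroup A] [Fintype ι]

/-- the Hecke operator on cochains: `(T χ)(γ) = Σ_i χ(α i · γ · α (σ γ i)⁻¹)`. -/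
def op (χ : Γ → A) : Γ → A := fun γ => ∑ i, χ ⟨H.α i * γ * (H.α (H.σ γ i))⁻¹, H.mem γ i⟩

/-- unfolding of the Hecke operator on cochains. [folklore] -/
theorem op_apply (χ : Γ → A) (γ : Γ) : H.op χ γ = ∑ i, χ ⟨H.α i * γ * (H.α (H.σ γ i))⁻¹, H.mem γ i⟩ := rfl

/-- **(T1) additivity**: the Hecke operator preserves additive cochains (homomorphisms `Γ → A`). [folklore] -/
theorem op_mul (χ : Γ → A) (hχ : ∀ a b : Γ, χ (a * b) = χ a + χ b) (γ δ : Γ) :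
    H.op χ (γ * δ) = H.op χ γ + H.op χ δ := by
  classical
  rw [op_apply, op_apply, op_apply]
  have key : ∀ i, χ ⟨H.α i * ((γ * δ : Γ) : 𝔾) * (H.α (H.σ (γ * δ) i))⁻¹, H.mem (γ * δ) i⟩
      = χ ⟨H.α i * γ * (H.α (H.σ γ i))⁻¹, H.mem γ i⟩ + χ ⟨H.α (H.σ γ i) * δ * (H.α (H.σ δ (H.σ γ i)))⁻¹, H.mem δ (H.σ γ i)⟩ := by
    intro i
    rw [← hχ]; congr 1; apply Subtype.ext
    simp only [Subgroup.coe_mul, H.σ_mul]; group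
  rw [Finset.sum_congr rfl (fun i _ => key i), Finset.sum_add_distrib]
  congr 1
  exact Equiv.sum_comp (H.σ γ) (fun j => χ ⟨H.α j * δ * (H.α (H.σ δ j))⁻¹, H.mem δ j⟩)

/-- **(T2) normalised elements**: on an element `β` NORMALISED INTO `Γ` by every representative (`α i β α i⁻¹ ∈ Γ`), the coset
permutation is trivial and `(T χ)(β) = Σ_i χ(α i β α i⁻¹)`. (CAVEAT, v9.5: for `N = Γ̄(q)` and `α i` of norm `ℓ` this hypothesis is NOT met — `α i β α i⁻¹` is not
`ℓ`-integral in general and `σ β` acts on the cosets through `β mod ℓ`; the compatibility `res ∘ T_Γ = T_N ∘ res` actually used is (T2′) `op_restrict` below, whose hypothesis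
`α i β α(σ β i)⁻¹ ∈ N` is supplied by `memN_of_reduction` from representatives with a COMMON reduction mod `q`, arranged via (M0).) [folklore] -/
theorem op_apply_of_normalised (χ : Γ → A) (β : Γ) (hβ : ∀ i, H.α i * β * (H.α i)⁻¹ ∈ Γ) :
    H.op χ β = ∑ i, χ ⟨H.α i * β * (H.α i)⁻¹, hβ i⟩ := by
  classical
  rw [op_apply]
  apply Finset.sum_congr rfl
  intro i _
  have hi : H.σ β i = i := (H.σ_unique β i i (hβ i)).symm
  congr 1; apply Subtype.ext; simp only [hi]

/-- **(T2′) restriction to a subgroup served by the same representatives**: if for `β ∈ N ≤ Γ` the elements `α i · β · α (σ β i)⁻¹` lie in `N` (not only in `Γ`) — i.e.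
`N α N = ⊔ N α i` with the SAME representatives — the datum restricts to `N` (same `α`, same coset permutations). [cite: ShimuraIATAF1971, §3.3–3.4] -/
def restrict (N : Subgroup 𝔾) (hN : N ≤ Γ) (memN : ∀ (β : N) (i : ι), H.α i * β * (H.α (H.σ ⟨β, hN β.2⟩ i))⁻¹ ∈ N) : HeckeDatum N ι where
  α := H.α
  σ := fun β => H.σ ⟨β, hN β.2⟩
  mem := memN
  disj := fun i j g hg h => H.disj i j g (hN hg) h

/-- `res ∘ T_Γ = T_N ∘ res`: on `β ∈ N` the Hecke operator of `Γ` IS the Hecke operator of the restricted datum applied to the restricted cochain (definitionally).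
[cite: ShimuraIATAF1971, §3.4] -/
theorem op_restrict (N : Subgroup 𝔾) (hN : N ≤ Γ) (memN : ∀ (β : N) (i : ι), H.α i * β * (H.α (H.σ ⟨β, hN β.2⟩ i))⁻¹ ∈ N)
    (χ : Γ → A) (β : N) :
    H.op χ ⟨β, hN β.2⟩ = (H.restrict N hN memN).op (fun x : N => χ ⟨x, hN x.2⟩) β := by
  rw [op_apply, op_apply]; rfl

omit [Fintype ι] in
/-- **criterion for (T2′) via a reduction map**: if `Γ` and all representatives lie in a subgroup `𝔾'` carrying a homomorphism `r : 𝔾' → Q` (reduction `mod q`), `N = Γ ∩ ker r`,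
and ALL REPRESENTATIVES HAVE THE SAME REDUCTION (`r (α i) = r (α j)` — arranged by left-multiplying the `α i` by elements of `Γ`, which is possible as soon as `r(Γ)`
contains the quotients `r(α i) r(α j)⁻¹`: for `Γ = ι(O₀'¹)` and `r = red`, these have determinant `1` and (M0) `red(Γ) = SL₂(𝔽_q)` supplies them), then the same representatives
serve `N`: `α i β α (σ β i)⁻¹ ∈ N` for `β ∈ N`. [folklore] -/
theorem memN_of_reduction {𝔾' : Subgroup 𝔾} {Q : Type*} [Group Q] (r : 𝔾' →* Q) (hΓ : Γ ≤ 𝔾') (hα : ∀ i, H.α i ∈ 𝔾')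
    (N : Subgroup 𝔾) (hNΓ : N ≤ Γ) (hN : ∀ (g : 𝔾) (hg : g ∈ Γ), g ∈ N ↔ r ⟨g, hΓ hg⟩ = 1)
    (hconst : ∀ i j, r ⟨H.α i, hα i⟩ = r ⟨H.α j, hα j⟩) :
    ∀ (β : N) (i : ι), H.α i * β * (H.α (H.σ ⟨β, hNΓ β.2⟩ i))⁻¹ ∈ N := by
  intro β i
  set γ : Γ := ⟨β, hNΓ β.2⟩ with hγ
  have hδΓ : H.α i * β * (H.α (H.σ γ i))⁻¹ ∈ Γ := H.mem γ i
  rw [hN _ hδΓ]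
  have hβ1 : r ⟨(β : 𝔾), hΓ (hNΓ β.2)⟩ = 1 := (hN (β : 𝔾) (hNΓ β.2)).mp β.2
  have e : (⟨H.α i * β * (H.α (H.σ γ i))⁻¹, hΓ hδΓ⟩ : 𝔾') = ⟨H.α i, hα i⟩ * ⟨(β : 𝔾), hΓ (hNΓ β.2)⟩ * ⟨H.α (H.σ γ i), hα _⟩⁻¹ := by
    apply Subtype.ext; simp only [Subgroup.coe_mul, Subgroup.coe_inv]
  rw [e, map_mul, map_mul, map_inv, hβ1, mul_one, hconst i (H.σ γ i), mul_inv_cancel]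

/-- **(T8) change of representatives**: replacing `α i` by `g i · α i` (`g i ∈ Γ`) gives a Hecke datum with the same coset permutations. [folklore] -/
def changeReps (g : ι → Γ) : HeckeDatum Γ ι where
  α := fun i => (g i : 𝔾) * H.α i
  σ := H.σ
  mem := by
    intro γ i
    have h := H.mem γ i
    have e : (g i : 𝔾) * H.α i * γ * ((g (H.σ γ i) : 𝔾) * H.α (H.σ γ i))⁻¹
        = g i * (H.α i * γ * (H.α (H.σ γ i))⁻¹) * ((g (H.σ γ i) : 𝔾))⁻¹ := by group
    rw [e]
    exact Γ.mul_mem (Γ.mul_mem (g i).2 h) (Γ.inv_mem (g _).2)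
  disj := by
    intro i j x hx h
    apply H.disj i j ((g i : 𝔾)⁻¹ * x * g j) (Γ.mul_mem (Γ.mul_mem (Γ.inv_mem (g i).2) hx) (g j).2)
    calc H.α i = (g i : 𝔾)⁻¹ * ((g i : 𝔾) * H.α i) := by group
      _ = (g i : 𝔾)⁻¹ * (x * ((g j : 𝔾) * H.α j)) := by rw [h]
      _ = (g i : 𝔾)⁻¹ * x * g j * H.α j := by group

/-- **the Hecke operator does not depend on the representatives** (for additive cochains). [cite: ShimuraIATAF1971, §3.4 / §8.3] -/
theorem op_changeReps (g : ι → Γ) (χ : Γ → A) (hχ : ∀ a b : Γ, χ (a * b) = χ a + χ b) (γ : Γ) :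
    (H.changeReps g).op χ γ = H.op χ γ := by
  classical
  have hχ1 : χ 1 = 0 := by
    have h := hχ 1 1; rw [mul_one] at h
    have h' : χ 1 + χ 1 = χ 1 + 0 := by rw [add_zero]; exact h.symm
    exact add_left_cancel h'
  have hχinv : ∀ a : Γ, χ a⁻¹ = -χ a := by
    intro a; have := hχ a a⁻¹; rw [mul_inv_cancel, hχ1] at this; exact (neg_eq_of_add_eq_zero_right this.symm).symm
  rw [op_apply, op_apply]
  have key : ∀ i, χ ⟨(H.changeReps g).α i * γ * ((H.changeReps g).α ((H.changeReps g).σ γ i))⁻¹, (H.changeReps g).mem γ i⟩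
      = χ (g i) + χ ⟨H.α i * γ * (H.α (H.σ γ i))⁻¹, H.mem γ i⟩ - χ (g (H.σ γ i)) := by
    intro i
    have e : (⟨(H.changeReps g).α i * γ * ((H.changeReps g).α ((H.changeReps g).σ γ i))⁻¹, (H.changeReps g).mem γ i⟩ : Γ)
        = g i * ⟨H.α i * γ * (H.α (H.σ γ i))⁻¹, H.mem γ i⟩ * (g (H.σ γ i))⁻¹ := by
      apply Subtype.ext
      simp only [changeReps, Subgroup.coe_mul, Subgroup.coe_inv]
      group
    rw [e, hχ, hχ, hχinv, sub_eq_add_neg]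
  rw [Finset.sum_congr rfl (fun i _ => key i), Finset.sum_sub_distrib, Finset.sum_add_distrib,
    Equiv.sum_comp (H.σ γ) (fun j => χ (g j))]
  abel

omit [Fintype ι] in
/-- **(T9) common reduction of the representatives**: if the quotients `r(α i₀) r(α i)⁻¹` of the reductions are reductions of elements of `Γ` (for `Γ = ι(O₀'¹)`, `r = red`:
they have determinant `1`, and (M0) `red(Γ) = SL₂(𝔽_q)`), then after a change of representatives all `α i` have the reduction of `α i₀`. [folklore] -/
theorem exists_changeReps_commonReduction {𝔾' : Subgroup 𝔾} {Q : Type*} [Group Q] (r : 𝔾' →* Q) (hΓ : Γ ≤ 𝔾')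
    (hα : ∀ i, H.α i ∈ 𝔾') (i₀ : ι)
    (hhit : ∀ i, ∃ (γ : 𝔾) (hγ : γ ∈ Γ), r ⟨γ, hΓ hγ⟩ = r ⟨H.α i₀, hα i₀⟩ * (r ⟨H.α i, hα i⟩)⁻¹) :
    ∃ g : ι → Γ, ∀ i, r ⟨(g i : 𝔾) * H.α i, 𝔾'.mul_mem (hΓ (g i).2) (hα i)⟩ = r ⟨H.α i₀, hα i₀⟩ := by
  choose γ hγ hr using hhit
  refine ⟨fun i => ⟨γ i, hγ i⟩, fun i => ?_⟩
  have e : (⟨γ i * H.α i, 𝔾'.mul_mem (hΓ (hγ i)) (hα i)⟩ : 𝔾') = ⟨γ i, hΓ (hγ i)⟩ * ⟨H.α i, hα i⟩ := by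
    apply Subtype.ext; simp only [Subgroup.coe_mul]
  simp only [e, map_mul, hr, inv_mul_cancel_right]

/-- **(T3) vanishing at elliptic `3`-cycle elements**: if `x³ = c` with `c` central in `𝔾` and `χ`-null, and the coset permutation of `x` is fixed-point-free, then
`(T χ)(x) = 0` for every additive `χ`. (`(σ x)³ = σ (x³) = σ c = 1` is automatic.) [folklore] -/
theorem op_apply_eq_zero_of_cube_central [DecidableEq ι] (χ : Γ → A) (hχ : ∀ a b : Γ, χ (a * b) = χ a + χ b)
    (x c : Γ) (hx : x ^ 3 = c) (hc : ∀ g : 𝔾, g * c = c * g) (hχc : χ c = 0) (hfix : ∀ i, H.σ x i ≠ i) :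
    H.op χ x = 0 := by
  classical
  have hσ3 : H.σ x ^ 3 = 1 := by
    ext i
    have e3 : (H.σ x ^ 3) i = H.σ (x ^ 3) i := by
      simp only [pow_succ, pow_zero, one_mul, Equiv.Perm.mul_apply, H.σ_mul]
    rw [e3, hx, H.σ_eq_self_of_comm c (fun j => hc (H.α j)) i, Equiv.Perm.one_apply]
  have hσ3i : ∀ i, H.σ x (H.σ x (H.σ x i)) = i := by
    intro i
    have := congrArg (fun τ : Equiv.Perm ι => τ i) hσ3
    simpa [pow_succ, Equiv.Perm.mul_apply] using this
  rw [op_apply]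
  refine sum_eq_zero_of_three_cycles (H.σ x) hfix hσ3 _ (fun i => ?_)
  rw [← hχ, ← hχ]
  have : (⟨H.α i * x * (H.α (H.σ x i))⁻¹, H.mem x i⟩ : Γ) * ⟨H.α (H.σ x i) * x * (H.α (H.σ x (H.σ x i)))⁻¹, H.mem x (H.σ x i)⟩ *
      ⟨H.α (H.σ x (H.σ x i)) * x * (H.α (H.σ x (H.σ x (H.σ x i))))⁻¹, H.mem x (H.σ x (H.σ x i))⟩ = c := by
    apply Subtype.ext
    simp only [Subgroup.coe_mul, hσ3i]
    have hx' : (x : 𝔾) * x * x = c := by rw [← Subgroup.coe_mul, ← Subgroup.coe_mul, ← hx, pow_succ, pow_two]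
    calc H.α i * x * (H.α (H.σ x i))⁻¹ * (H.α (H.σ x i) * x * (H.α (H.σ x (H.σ x i)))⁻¹) * (H.α (H.σ x (H.σ x i)) * x * (H.α i)⁻¹)
        = H.α i * ((x : 𝔾) * x * x) * (H.α i)⁻¹ := by group
      _ = c := by rw [hx', hc, mul_assoc, mul_inv_cancel, mul_one]
  rw [this, hχc]

/-- **(T4) eigen-cochains vanish at elliptic `3`-cycle elements when the eigenvalue is prime to `3`**: `T χ = a χ` pointwise, `3χ = 0`, `3 ∤ a` ⇒ `χ(x) = 0`
for every `x` as in (T3). [folklore] -/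
theorem apply_eq_zero_of_eigen [DecidableEq ι] (χ : Γ → A) (hχ : ∀ a b : Γ, χ (a * b) = χ a + χ b) (h3 : ∀ γ, 3 • χ γ = 0)
    (a : ℤ) (ha : ¬ (3 : ℤ) ∣ a) (heig : ∀ γ, H.op χ γ = a • χ γ)
    (x c : Γ) (hx : x ^ 3 = c) (hc : ∀ g : 𝔾, g * c = c * g) (hχc : χ c = 0) (hfix : ∀ i, H.σ x i ≠ i) :
    χ x = 0 := by
  have h0 : a • χ x = 0 := by rw [← heig]; exact H.op_apply_eq_zero_of_cube_central χ hχ x c hx hc hχc hfix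
  have h3x : (3 : ℤ) • χ x = 0 := by rw [show (3 : ℤ) = ((3 : ℕ) : ℤ) from rfl, natCast_zsmul]; exact h3 x
  -- Bezout: gcd(a, 3) = 1
  have hcop : IsCoprime a 3 := by
    rw [Int.isCoprime_iff_gcd_eq_one]
    have h := Int.gcd_dvd_right a 3
    have h1 : Int.gcd a 3 ∣ 3 := by exact_mod_cast h
    rcases (Nat.dvd_prime Nat.prime_three).mp h1 with h2 | h2
    · exact h2
    · exfalso; apply ha
      have := Int.gcd_dvd_left a 3
      rw [h2] at this; exact_mod_cast this
  obtain ⟨u, v, huv⟩ := hcop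
  calc χ x = (1 : ℤ) • χ x := (one_zsmul _).symm
    _ = (u * a + v * 3) • χ x := by rw [huv]
    _ = 0 := by rw [add_zsmul, mul_zsmul, mul_zsmul, h0, h3x, zsmul_zero, zsmul_zero, add_zero]

/-- **(T5) eigen-transfer through a res-injective subgroup**: if every additive `3`-torsion cochain on `Γ` vanishing on the set `N` vanishes identically (RES-INJ), and the
additive `3`-torsion cochain `χ` satisfies the eigen-relation `(Tχ)(β) = a·χ(β)` for `β ∈ N`, then `Tχ = aχ` on all of `Γ`. [folklore; the use of RES-INJ in the inert-Hecke
certificate] -/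
theorem eigen_of_eigen_on (N : Set Γ)
    (hinj : ∀ ψ : Γ → A, (∀ a b : Γ, ψ (a * b) = ψ a + ψ b) → (∀ γ, 3 • ψ γ = 0) → (∀ β ∈ N, ψ β = 0) → ∀ γ, ψ γ = 0)
    (χ : Γ → A) (hχ : ∀ a b : Γ, χ (a * b) = χ a + χ b) (h3 : ∀ γ, 3 • χ γ = 0) (a : ℤ)
    (heigN : ∀ β ∈ N, H.op χ β = a • χ β) : ∀ γ, H.op χ γ = a • χ γ := by
  let ψ : Γ → A := fun γ => H.op χ γ - a • χ γ
  have hψ : ∀ x y : Γ, ψ (x * y) = ψ x + ψ y := by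
    intro x y
    simp only [ψ, H.op_mul χ hχ, hχ, smul_add]
    abel
  have hop3 : ∀ γ, 3 • H.op χ γ = 0 := by
    intro γ; rw [op_apply, Finset.smul_sum]; simp only [h3, Finset.sum_const_zero]
  have hψ3 : ∀ γ, 3 • ψ γ = 0 := by
    intro γ
    simp only [ψ, smul_sub, hop3]
    rw [smul_comm (3 : ℕ) a (χ γ), h3, smul_zero, sub_zero]
  have hψN : ∀ β ∈ N, ψ β = 0 := fun β hβ => by simp only [ψ, heigN β hβ, sub_self]
  intro γ
  have := hinj ψ hψ hψ3 hψN γ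
  exact sub_eq_zero.mp this

end HeckeDatum

end InertHecke

end Summit.BirchSwinnertonDyer.BirchSwinnertonDyer.Theorems.CartanCover.Charext

end
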